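import Mathlib.Analysis.SpecialFunctions.Pow.Real
import Mathlib.Analysis.Convex.SpecificFunctions.Basic
import Mathlib.Algebra.BigOperators.Intervals

/-!
# `BalabanUV.Beta.GAN24.DirichletRingGronwall` — binder row G-an2-4 / (CONV-C), road P2 PART IV, leaf L7 (+ the product bound of L2) of the ring
# lemma: THE DISCRETE GRÖNWALL LEMMA WITH A CRITICAL SOURCE (unit b2b-balaban-gan24-p2, gen 24, v1)

HONEST FRAMING (cell contract, verbatim): «discharging `BetaPertH` makes Bałaban's UV stability UNCONDITIONAL — a real constructive-QFT
result; it is NOT the continuum limit and NOT the Clay problem.»  Pure real-analysis brick for the ring lemma of memo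
`HOME/b2b-balaban-gan24-p2/gen24/W-FULL-WEIGHTED.md` §3 (leaf L7): the square-ring energies `e_k` around a re-entrant vertex satisfy
`e_{k−1} ≤ (1 − θ_k)e_k + s_k` with a gain `θ_k ≥ γ/(k+A)` (γ = (π/3)(1−ε/2) > 1 from the sharp Wirtinger constant, file
`DirichletRingWirtinger`) and a source `s_k ≤ B·(k+A)` of CRITICAL size; this file turns that into the power decay
`e_a ≤ ((a+1+A)/(b+1+A))^γ·(e_b + B(b+1+A)²/(2−γ))` — the source is summable at the top exactly because `γ < 2`.

 * §1 `unroll` — the recursion unrolled (induction): `e_a ≤ Π(1−θ_k)·e_b + Σ_k s_k·Π_{j<k}(1−θ_j)`.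
 * §2 `prod_one_sub_le_rpow` — `Π_{a<k≤b}(1−θ_k) ≤ ((a+1+A)/(b+1+A))^γ` when `γ/(k+A) ≤ θ_k ≤ 1` (`1 − t ≤ e^{−t}`, `log x ≤ x − 1`,
   telescoping `sum_log_telescope`).
 * §3 `sum_rpow_sub_one_le` — `Σ_{k=1}^{n} k^{s−1} ≤ n^s/s` for `0 < s ≤ 1` (Bernoulli `(1 − 1/k)^s ≤ 1 − s/k`, telescoping).
 * §4 **`decay_of_recursion`** — the assembled power decay with the critical source.

ABSOLUTE RULE (cell, verbatim): «No internally-minted statement may enter as a cited fact. Every hypothesis is either kernel-proved in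
this package or a verbatim quotation of a PUBLISHED theorem with page reference. The manuscript(s) under audit are NOT citable for
their own disputed steps — they are the thing under adjudication; programme-internal (2001/route/tribunal) claims are never citable.»
[folklore] elementary real analysis; nothing printed is a hypothesis.  NOT CLAIMED: the ring lemma (L3–L6, L8), (A)/(B), NE2, (CONV-C),
`BetaPertH`, continuum, Clay.  «not in print; our proof attempt».  HONEST DEPENDENCY: continuum YM on T⁴ ⇐ BetaPertH ∧ nine spine estimates
(0/9 proved); BetaPertH ⇐ (D1) ∧ (D4) ∧ CAP+tail; G-an2-4 gates asym, D1 and NE2/3/4.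
-/

noncomputable section

open scoped BigOperators
open Finset Real

namespace Summit.QuantumFields.BalabanUV.Beta.GAN24.DirichletRingGronwall

/-! ## §1 The recursion unrolled -/

/-- **unrolling**: if `e_{k−1} ≤ (1−θ_k)e_k + s_k` for `a < k ≤ b` with `θ_k ≤ 1`, then
`e_a ≤ (Π_{a<k≤b}(1−θ_k))·e_b + Σ_{a<k≤b} s_k·Π_{a<j≤k−1}(1−θ_j)`. [folklore] -/
theorem unroll (e θ s : ℕ → ℝ) {a b : ℕ} (hab : a ≤ b) (hθ1 : ∀ k, a < k → k ≤ b → θ k ≤ 1)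
    (hrec : ∀ k, a < k → k ≤ b → e (k - 1) ≤ (1 - θ k) * e k + s k) :
    e a ≤ (∏ k ∈ Ioc a b, (1 - θ k)) * e b + ∑ k ∈ Ioc a b, s k * ∏ j ∈ Ioc a (k - 1), (1 - θ j) := by
  induction b, hab using Nat.le_induction with
  | base => simp
  | succ b hab ih =>
      have hP : 0 ≤ ∏ k ∈ Ioc a b, (1 - θ k) :=
        Finset.prod_nonneg fun k hk => by
          have := Finset.mem_Ioc.mp hk
          linarith [hθ1 k this.1 (by omega)]
      have hstep : e b ≤ (1 - θ (b + 1)) * e (b + 1) + s (b + 1) := by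
        have := hrec (b + 1) (by omega) le_rfl
        simpa using this
      have ih' := ih (fun k hk hkb => hθ1 k hk (by omega)) (fun k hk hkb => hrec k hk (by omega))
      rw [Finset.prod_Ioc_succ_top hab, Finset.sum_Ioc_succ_top hab, Nat.add_sub_cancel]
      calc e a ≤ (∏ k ∈ Ioc a b, (1 - θ k)) * e b + ∑ k ∈ Ioc a b, s k * ∏ j ∈ Ioc a (k - 1), (1 - θ j) := ih'
        _ ≤ (∏ k ∈ Ioc a b, (1 - θ k)) * ((1 - θ (b + 1)) * e (b + 1) + s (b + 1))
              + ∑ k ∈ Ioc a b, s k * ∏ j ∈ Ioc a (k - 1), (1 - θ j) := by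
            gcongr
        _ = (∏ k ∈ Ioc a b, (1 - θ k)) * (1 - θ (b + 1)) * e (b + 1)
              + (∑ k ∈ Ioc a b, s k * ∏ j ∈ Ioc a (k - 1), (1 - θ j) + s (b + 1) * ∏ k ∈ Ioc a b, (1 - θ k)) := by ring

/-! ## §2 The product bound -/

/-- one factor: `1 − θ ≤ exp(−γ/(k+A))` when `γ/(k+A) ≤ θ`. [folklore] -/
theorem one_sub_le_exp {θ γ x : ℝ} (h : γ / x ≤ θ) : 1 - θ ≤ Real.exp (-(γ / x)) :=
  (by linarith : 1 - θ ≤ 1 - γ / x).trans (Real.one_sub_le_exp_neg _)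

/-- the telescoping sum `Σ_{a<k≤b} log((k+1+A)/(k+A)) = log(b+1+A) − log(a+1+A)`. [folklore] -/
theorem sum_log_telescope (A : ℝ) (hA : 0 ≤ A) {a b : ℕ} (hab : a ≤ b) :
    ∑ k ∈ Ioc a b, Real.log (((k : ℝ) + 1 + A) / ((k : ℝ) + A)) = Real.log ((b : ℝ) + 1 + A) - Real.log ((a : ℝ) + 1 + A) := by
  induction b, hab using Nat.le_induction with
  | base => simp
  | succ b hab ih =>
      rw [Finset.sum_Ioc_succ_top hab, ih]
      have h1 : (0 : ℝ) < (b : ℝ) + 1 + A := by positivity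
      have h2 : (0 : ℝ) < ((b + 1 : ℕ) : ℝ) + 1 + A := by positivity
      rw [Real.log_div (by push_cast; positivity) (by push_cast; positivity)]
      push_cast
      ring

/-- **THE PRODUCT BOUND**: if `γ/(k+A) ≤ θ_k ≤ 1` for `a < k ≤ b` (`γ, A ≥ 0`), then
`Π_{a<k≤b}(1 − θ_k) ≤ ((a+1+A)/(b+1+A))^γ`. [folklore] -/
theorem prod_one_sub_le_rpow (θ : ℕ → ℝ) {γ A : ℝ} (hγ : 0 ≤ γ) (hA : 0 ≤ A) {a b : ℕ} (hab : a ≤ b)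
    (hθ : ∀ k, a < k → k ≤ b → γ / ((k : ℝ) + A) ≤ θ k) (hθ1 : ∀ k, a < k → k ≤ b → θ k ≤ 1) :
    ∏ k ∈ Ioc a b, (1 - θ k) ≤ (((a : ℝ) + 1 + A) / ((b : ℝ) + 1 + A)) ^ γ := by
  have ha0 : (0 : ℝ) < (a : ℝ) + 1 + A := by positivity
  have hb0 : (0 : ℝ) < (b : ℝ) + 1 + A := by positivity
  -- each factor `≤ exp(−γ/(k+A))`
  have h1 : ∏ k ∈ Ioc a b, (1 - θ k) ≤ ∏ k ∈ Ioc a b, Real.exp (-(γ / ((k : ℝ) + A))) := by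
    refine Finset.prod_le_prod (fun k hk => ?_) (fun k hk => ?_)
    · have := Finset.mem_Ioc.mp hk; linarith [hθ1 k this.1 this.2]
    · have := Finset.mem_Ioc.mp hk; exact one_sub_le_exp (hθ k this.1 this.2)
  -- the exponent: `−γ Σ 1/(k+A) ≤ −γ (log(b+1+A) − log(a+1+A))`
  have h2 : ∏ k ∈ Ioc a b, Real.exp (-(γ / ((k : ℝ) + A))) = Real.exp (-(γ * ∑ k ∈ Ioc a b, 1 / ((k : ℝ) + A))) := by
    rw [← Real.exp_sum, Finset.mul_sum, ← Finset.sum_neg_distrib]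
    refine congrArg Real.exp (Finset.sum_congr rfl fun k _ => ?_)
    ring
  have h3 : Real.log ((b : ℝ) + 1 + A) - Real.log ((a : ℝ) + 1 + A) ≤ ∑ k ∈ Ioc a b, 1 / ((k : ℝ) + A) := by
    rw [← sum_log_telescope A hA hab]
    refine Finset.sum_le_sum fun k hk => ?_
    have hk0 : (0 : ℝ) < (k : ℝ) + A := by
      have := (Finset.mem_Ioc.mp hk).1
      have : (1 : ℝ) ≤ k := by exact_mod_cast Nat.succ_le_of_lt (lt_of_le_of_lt (Nat.zero_le a) this)
      linarith
    -- `log((x+1)/x) ≤ (x+1)/x − 1 = 1/x` with `x = k + A` (the lemma `log_succ_div_le` of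
    -- `Literature.Barriers.RiemannHypothesis.TuranPartialSumsShiftEnclose` — re-derived inline to keep the imports topical)
    have hlog := Real.log_le_sub_one_of_pos (show 0 < ((k : ℝ) + 1 + A) / ((k : ℝ) + A) by positivity)
    have e : ((k : ℝ) + 1 + A) / ((k : ℝ) + A) - 1 = 1 / ((k : ℝ) + A) := by field_simp; ring
    linarith [hlog, e.le, e.ge]
  have h4 : Real.exp (-(γ * ∑ k ∈ Ioc a b, 1 / ((k : ℝ) + A)))
      ≤ Real.exp (-(γ * (Real.log ((b : ℝ) + 1 + A) - Real.log ((a : ℝ) + 1 + A)))) := by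
    rw [Real.exp_le_exp]
    nlinarith [mul_le_mul_of_nonneg_left h3 hγ]
  have h5 : Real.exp (-(γ * (Real.log ((b : ℝ) + 1 + A) - Real.log ((a : ℝ) + 1 + A))))
      = (((a : ℝ) + 1 + A) / ((b : ℝ) + 1 + A)) ^ γ := by
    rw [Real.rpow_def_of_pos (by positivity), Real.log_div ha0.ne' hb0.ne']
    congr 1
    ring
  calc ∏ k ∈ Ioc a b, (1 - θ k) ≤ _ := h1
    _ = _ := h2
    _ ≤ _ := h4
    _ = _ := h5

/-! ## §3 The power sum -/

/-- one step: `s·k^{s−1} ≤ k^s − (k−1)^s` for `k ≥ 1`, `0 < s ≤ 1` (Bernoulli). [folklore] -/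
theorem mul_rpow_sub_one_le {s : ℝ} (hs0 : 0 < s) (hs1 : s ≤ 1) {k : ℕ} (hk : 1 ≤ k) :
    s * (k : ℝ) ^ (s - 1) ≤ (k : ℝ) ^ s - ((k : ℝ) - 1) ^ s := by
  have hkR : (1 : ℝ) ≤ k := by exact_mod_cast hk
  have hk0 : (0 : ℝ) < k := by linarith
  -- Bernoulli: `(1 − 1/k)^s ≤ 1 − s/k`
  have hB : (1 + (-(1 / (k : ℝ)))) ^ s ≤ 1 + s * (-(1 / (k : ℝ))) :=
    rpow_one_add_le_one_add_mul_self (by rw [neg_le_neg_iff, div_le_one hk0]; exact hkR) hs0.le hs1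
  have e1 : ((k : ℝ) - 1) ^ s = (k : ℝ) ^ s * (1 + (-(1 / (k : ℝ)))) ^ s := by
    rw [← Real.mul_rpow hk0.le (by rw [← sub_eq_add_neg, sub_nonneg, div_le_one hk0]; exact hkR)]
    congr 1
    field_simp
    ring
  have e2 : (k : ℝ) ^ (s - 1) = (k : ℝ) ^ s / k := by
    rw [Real.rpow_sub_one hk0.ne']
  rw [e1, e2]
  have hks : 0 ≤ (k : ℝ) ^ s := Real.rpow_nonneg hk0.le s
  have h := mul_le_mul_of_nonneg_left hB hks
  have e3 : (k : ℝ) ^ s * (1 + s * (-(1 / (k : ℝ)))) = (k : ℝ) ^ s - s * ((k : ℝ) ^ s / k) := by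
    field_simp
    ring
  linarith [h, e3.le, e3.ge]

/-- **THE POWER SUM**: `Σ_{k=1}^{n} k^{s−1} ≤ n^s/s` for `0 < s ≤ 1`. [folklore] -/
theorem sum_rpow_sub_one_le {s : ℝ} (hs0 : 0 < s) (hs1 : s ≤ 1) (n : ℕ) :
    ∑ k ∈ Icc 1 n, (k : ℝ) ^ (s - 1) ≤ (n : ℝ) ^ s / s := by
  rw [le_div_iff₀ hs0, Finset.sum_mul]
  have htel : ∀ n : ℕ, ∑ k ∈ Icc 1 n, ((k : ℝ) ^ s - ((k : ℝ) - 1) ^ s) = (n : ℝ) ^ s := by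
    intro n
    induction n with
    | zero => simp [Real.zero_rpow hs0.ne']
    | succ n ih =>
        rw [Finset.sum_Icc_succ_top (by omega), ih]
        push_cast
        ring
  calc ∑ k ∈ Icc 1 n, (k : ℝ) ^ (s - 1) * s = ∑ k ∈ Icc 1 n, s * (k : ℝ) ^ (s - 1) := by
        refine Finset.sum_congr rfl fun k _ => mul_comm _ _
    _ ≤ ∑ k ∈ Icc 1 n, ((k : ℝ) ^ s - ((k : ℝ) - 1) ^ s) :=
        Finset.sum_le_sum fun k hk => mul_rpow_sub_one_le hs0 hs1 (Finset.mem_Icc.mp hk).1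
    _ = (n : ℝ) ^ s := htel n

/-! ## §4 The power decay with a critical source -/

/-- **THE DISCRETE GRÖNWALL LEMMA WITH A CRITICAL SOURCE**: let `1 < γ < 2`, `A : ℕ`, `B ≥ 0`, and for `a < k ≤ b`:
`e_{k−1} ≤ (1 − θ_k)e_k + s_k`, `γ/(k+A) ≤ θ_k ≤ 1`, `s_k ≤ B·(k+A)`, with `e ≥ 0`.  Then
`e_a ≤ ((a+1+A)/(b+1+A))^γ · (e_b + B·(b+1+A)²/(2−γ))`. [folklore] -/
theorem decay_of_recursion (e θ s : ℕ → ℝ) {γ B : ℝ} (hγ1 : 1 < γ) (hγ2 : γ < 2) (hB : 0 ≤ B) (A : ℕ) {a b : ℕ}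
    (hab : a ≤ b) (he : ∀ k, 0 ≤ e k)
    (hrec : ∀ k, a < k → k ≤ b → e (k - 1) ≤ (1 - θ k) * e k + s k)
    (hθ : ∀ k, a < k → k ≤ b → γ / ((k : ℝ) + A) ≤ θ k) (hθ1 : ∀ k, a < k → k ≤ b → θ k ≤ 1)
    (hs : ∀ k, a < k → k ≤ b → s k ≤ B * ((k : ℝ) + A)) :
    e a ≤ ((((a : ℝ) + 1 + A) / ((b : ℝ) + 1 + A)) ^ γ) * (e b + B * ((b : ℝ) + 1 + A) ^ 2 / (2 - γ)) := by
  have hγ0 : 0 ≤ γ := by linarith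
  have hA : (0 : ℝ) ≤ (A : ℝ) := Nat.cast_nonneg A
  have ha0 : (0 : ℝ) < (a : ℝ) + 1 + A := by positivity
  have hb0 : (0 : ℝ) < (b : ℝ) + 1 + A := by positivity
  set ρ : ℝ := (((a : ℝ) + 1 + A) / ((b : ℝ) + 1 + A)) ^ γ with hρ
  have hρ0 : 0 ≤ ρ := Real.rpow_nonneg (by positivity) γ
  -- §1 + §2 for the homogeneous part and for each partial product
  have hun := unroll e θ s hab hθ1 hrec
  have hP : ∏ k ∈ Ioc a b, (1 - θ k) ≤ ρ := prod_one_sub_le_rpow θ hγ0 hA hab hθ hθ1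
  have hPk : ∀ k ∈ Ioc a b, ∏ j ∈ Ioc a (k - 1), (1 - θ j) ≤ (((a : ℝ) + 1 + A) / ((k : ℝ) + A)) ^ γ := by
    intro k hk
    obtain ⟨hak, hkb⟩ := Finset.mem_Ioc.mp hk
    have h := prod_one_sub_le_rpow θ hγ0 hA (show a ≤ k - 1 by omega)
      (fun j hj hjk => hθ j hj (by omega)) (fun j hj hjk => hθ1 j hj (by omega))
    have e : (((k - 1 : ℕ) : ℝ) + 1 + A) = (k : ℝ) + A := by
      rw [Nat.cast_sub (by omega)]; push_cast; ring
    rwa [e] at h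
  -- the source sum: `Σ s_k Π ≤ B (a+1+A)^γ Σ (k+A)^{1−γ} ≤ B (a+1+A)^γ (b+A)^{2−γ}/(2−γ) ≤ ρ · B (b+1+A)²/(2−γ)`
  have hsrc : ∑ k ∈ Ioc a b, s k * ∏ j ∈ Ioc a (k - 1), (1 - θ j) ≤ ρ * (B * ((b : ℝ) + 1 + A) ^ 2 / (2 - γ)) := by
    have hs2 : 0 < 2 - γ := by linarith
    -- termwise
    have hterm : ∀ k ∈ Ioc a b, s k * ∏ j ∈ Ioc a (k - 1), (1 - θ j)
        ≤ B * ((a : ℝ) + 1 + A) ^ γ * (((k + A : ℕ) : ℝ)) ^ ((2 - γ) - 1) := by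
      intro k hk
      obtain ⟨hak, hkb⟩ := Finset.mem_Ioc.mp hk
      have hkA : (0 : ℝ) < (k : ℝ) + A := by
        have : (1 : ℝ) ≤ k := by exact_mod_cast Nat.succ_le_of_lt (lt_of_le_of_lt (Nat.zero_le a) hak)
        linarith
      have hprod0 : 0 ≤ ∏ j ∈ Ioc a (k - 1), (1 - θ j) :=
        Finset.prod_nonneg fun j hj => by
          have := Finset.mem_Ioc.mp hj; linarith [hθ1 j this.1 (by omega)]
      calc s k * ∏ j ∈ Ioc a (k - 1), (1 - θ j)
          ≤ (B * ((k : ℝ) + A)) * (((a : ℝ) + 1 + A) / ((k : ℝ) + A)) ^ γ :=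
            mul_le_mul (hs k hak hkb) (hPk k hk) hprod0 (by positivity)
        _ = B * ((a : ℝ) + 1 + A) ^ γ * (((k : ℝ) + A) * ((k : ℝ) + A) ^ (-γ)) := by
            rw [Real.div_rpow ha0.le hkA.le, Real.rpow_neg hkA.le]; ring
        _ = B * ((a : ℝ) + 1 + A) ^ γ * (((k + A : ℕ) : ℝ)) ^ ((2 - γ) - 1) := by
            push_cast
            rw [show (2 - γ) - 1 = 1 + (-γ) by ring, Real.rpow_add hkA, Real.rpow_one]
    -- the shifted power sum
    have hsum : ∑ k ∈ Ioc a b, (((k + A : ℕ) : ℝ)) ^ ((2 - γ) - 1) ≤ (((b + A : ℕ) : ℝ)) ^ (2 - γ) / (2 - γ) := by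
      have himg : ∑ k ∈ Ioc a b, (((k + A : ℕ) : ℝ)) ^ ((2 - γ) - 1)
          = ∑ j ∈ (Ioc a b).image (fun k => k + A), ((j : ℝ)) ^ ((2 - γ) - 1) := by
        rw [Finset.sum_image (fun x _ y _ h => by simpa using h)]
      rw [himg]
      refine le_trans (Finset.sum_le_sum_of_subset_of_nonneg ?_ (fun j _ _ => Real.rpow_nonneg (Nat.cast_nonneg j) _))
        (sum_rpow_sub_one_le hs2 (by linarith) (b + A))
      intro j hj
      obtain ⟨k, hk, rfl⟩ := Finset.mem_image.mp hj
      obtain ⟨hak, hkb⟩ := Finset.mem_Ioc.mp hk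
      exact Finset.mem_Icc.mpr ⟨by omega, by omega⟩
    have hpow : (((b + A : ℕ) : ℝ)) ^ (2 - γ) ≤ ((b : ℝ) + 1 + A) ^ (2 - γ) := by
      refine Real.rpow_le_rpow (by positivity) ?_ hs2.le
      push_cast; linarith
    calc ∑ k ∈ Ioc a b, s k * ∏ j ∈ Ioc a (k - 1), (1 - θ j)
        ≤ ∑ k ∈ Ioc a b, B * ((a : ℝ) + 1 + A) ^ γ * (((k + A : ℕ) : ℝ)) ^ ((2 - γ) - 1) := Finset.sum_le_sum hterm
      _ = B * ((a : ℝ) + 1 + A) ^ γ * ∑ k ∈ Ioc a b, (((k + A : ℕ) : ℝ)) ^ ((2 - γ) - 1) := by rw [Finset.mul_sum]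
      _ ≤ B * ((a : ℝ) + 1 + A) ^ γ * (((b : ℝ) + 1 + A) ^ (2 - γ) / (2 - γ)) := by
          refine mul_le_mul_of_nonneg_left (hsum.trans ?_) (by positivity)
          exact div_le_div_of_nonneg_right hpow hs2.le
      _ = ρ * (B * ((b : ℝ) + 1 + A) ^ 2 / (2 - γ)) := by
          -- `(a+1+A)^γ (b+1+A)^{2−γ} = ρ (b+1+A)^γ (b+1+A)^{2−γ} = ρ (b+1+A)²`
          rw [hρ, Real.div_rpow ha0.le hb0.le]
          have e2 : ((b : ℝ) + 1 + A) ^ (2 : ℝ) = ((b : ℝ) + 1 + A) ^ γ * ((b : ℝ) + 1 + A) ^ (2 - γ) := by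
            rw [← Real.rpow_add hb0]; ring_nf
          have hbγ : ((b : ℝ) + 1 + A) ^ γ ≠ 0 := (Real.rpow_pos_of_pos hb0 γ).ne'
          rw [show ((b : ℝ) + 1 + A) ^ 2 = ((b : ℝ) + 1 + A) ^ (2 : ℝ) by norm_cast, e2]
          field_simp
  calc e a ≤ (∏ k ∈ Ioc a b, (1 - θ k)) * e b + ∑ k ∈ Ioc a b, s k * ∏ j ∈ Ioc a (k - 1), (1 - θ j) := hun
    _ ≤ ρ * e b + ρ * (B * ((b : ℝ) + 1 + A) ^ 2 / (2 - γ)) :=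
        add_le_add (mul_le_mul_of_nonneg_right hP (he b)) hsrc
    _ = ρ * (e b + B * ((b : ℝ) + 1 + A) ^ 2 / (2 - γ)) := by ring

end Summit.QuantumFields.BalabanUV.Beta.GAN24.DirichletRingGronwall

end
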